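import Mathlib
import Literature.Probability.Percolation.DiagonalStripVertexEmbedding
import Literature.Probability.Percolation.DiagonalStripNCDepth
import Literature.Computability.QuantumComplexity.BravyiGossetPairData
import HarnessLib

/-!
# The embedding of the connectivity basis into the spin chain is injective

Topic `Literature/Probability/Percolation`. The `q`-singlet embedding `Mc(σ, s)` of
`DiagonalStripVertexEmbedding` is unitriangular: for the configuration **`tauConf s`** with `↓` at every
left endpoint and `↑` at every right endpoint of the arcs of `s`,
* `Mc(τ_s, s) = (-q)^{m+1}` (**`embMc_tauConf_self`**);
* if `Mc(σ, s') ≠ 0` then the height profile of `σ` is dominated by that of `τ_{s'}`, with equality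
  only for `σ = τ_{s'}` (**`dProfile_le_of_embMc_ne_zero`**, **`eq_tauConf_of_dProfile_eq`**);
* `s ↦ τ_s` is injective (**`tauConf_injective`**, from `eq_of_minmax_eq` of `DiagonalStripNCDepth`);
hence the columns `Mc(·, s)` are linearly independent (**`embMc_linearIndependent`**) and the embedding
has a left inverse with constant coefficients (**`exists_leftInverse_embMc`**).

## References

* Y. Ikhlef, A. K. Ponsaing, *Finite-size left-passage probability in percolation*, J. Stat. Phys.
  149 (2012) 10–36, arXiv:1202.5476, §3.1. [IkhlefPonsaing2012]
-/

noncomputable section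

namespace Literature.Probability.Percolation

open Finset Literature.Probability.LatticeModels Literature.Probability.LatticeModels.TemperleyLieb

variable {m : ℕ}

/-! ### The test configuration of a state -/

section Tau

/-- **The test configuration** `τ_s`: `↓` at the left endpoints, `↑` at the right endpoints of the
arcs of `s` (site `2p` is the out-position of `p`, site `2j-1` the in-position of `j`). [folklore] -/
def tauConf (s : NCState (m + 1)) : SpinConfig (2 * m + 1) := fun i =>
  if i.val % 2 = 0 then decide ((⟨i.val / 2, by omega⟩ : Fin (m + 1)) < nxt s ⟨i.val / 2, by omega⟩)
  else decide (IsBMin s (⟨(i.val + 1) / 2, by omega⟩ : Fin (m + 1)))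

variable (s : NCState (m + 1))

/-- The test configuration at an out-position. [folklore] -/
theorem sh_tauConf_out (p : Fin (m + 1)) : sh (tauConf s) (2 * p.val + 1) = decide (p < nxt s p) := by
  have hp := p.isLt
  unfold sh; rw [dif_pos ⟨by omega, by omega⟩]; unfold tauConf
  simp only
  rw [if_pos (by omega)]
  have : (⟨(2 * p.val + 1 - 1) / 2, by omega⟩ : Fin (m + 1)) = p := Fin.ext (by show (2 * p.val + 1 - 1) / 2 = p.val; omega)
  rw [this]

/-- The test configuration at an in-position. [folklore] -/
theorem sh_tauConf_in (j : Fin (m + 1)) : sh (tauConf s) (2 * j.val) = decide (IsBMin s j) := by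
  have hj := j.isLt
  rcases Nat.eq_zero_or_pos j.val with h0 | hpos
  · unfold sh; rw [dif_neg (by omega)]
    have : j = ⟨0, by omega⟩ := Fin.ext h0
    rw [this]; symm; rw [decide_eq_true_iff]; unfold IsBMin; exact fun h => absurd (Fin.lt_def.1 h) (by simp)
  · unfold sh; rw [dif_pos ⟨by omega, by omega⟩]; unfold tauConf
    simp only
    rw [if_neg (by omega)]
    have : (⟨(2 * j.val - 1 + 1) / 2, by omega⟩ : Fin (m + 1)) = j := Fin.ext (by show (2 * j.val - 1 + 1) / 2 = j.val; omega)
    rw [this]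

/-- The in-position of a successor is `↑` exactly when the arc is forward. [folklore] -/
theorem sh_tauConf_in_nxt (p : Fin (m + 1)) : sh (tauConf s) (2 * (nxt s p).val) = !decide (p < nxt s p) := by
  rw [sh_tauConf_in]
  have e : IsBMin s (nxt s p) ↔ ¬p < nxt s p := by unfold IsBMin; rw [prd_nxt]
  by_cases h : p < nxt s p <;> simp [h, e]

/-- **The diagonal coefficient**: `Mc(τ_s, s) = (-q)^{m+1}`. [folklore] -/
theorem embMc_tauConf_self (q : ℂ) : embMc q (tauConf s) s = (-q) ^ (m + 1) := by
  unfold embMc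
  rw [show (-q) ^ (m + 1) = ∏ _p : Fin (m + 1), (-q) by rw [prod_const, card_univ, Fintype.card_fin]]
  refine prod_congr rfl fun p _ => ?_
  unfold arcW
  rw [sh_tauConf_out, sh_tauConf_in_nxt]
  unfold Wt cW
  by_cases h : p < nxt s p <;> simp [h]

variable {s}

/-- **`s ↦ τ_s` is injective.** [folklore] -/
theorem tauConf_injective : Function.Injective (tauConf (m := m)) := by
  intro s s' h
  refine eq_of_minmax_eq s (fun p => ?_) (fun j => ?_)
  · have := congrFun h ⟨2 * p.val, by omega⟩
    unfold tauConf at this; simp only at this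
    rw [if_pos (by omega), if_pos (by omega)] at this
    have e : (⟨2 * p.val / 2, by omega⟩ : Fin (m + 1)) = p := Fin.ext (by show 2 * p.val / 2 = p.val; omega)
    rw [e] at this
    have h' : (p < nxt s p ↔ p < nxt s' p) := by simpa using this
    unfold IsBMax
    exact not_congr h'
  · rcases Nat.eq_zero_or_pos j.val with h0 | hpos
    · have : j = ⟨0, by omega⟩ := Fin.ext h0
      rw [this]; unfold IsBMin
      constructor <;> exact fun _ h' => absurd (Fin.lt_def.1 h') (by simp)
    · have := congrFun h ⟨2 * j.val - 1, by omega⟩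
      unfold tauConf at this; simp only at this
      rw [if_neg (by omega), if_neg (by omega)] at this
      have e : (⟨(2 * j.val - 1 + 1) / 2, by omega⟩ : Fin (m + 1)) = j := Fin.ext (by show (2 * j.val - 1 + 1) / 2 = j.val; omega)
      rw [e] at this
      simpa using this

end Tau

/-! ### The height profile and its dominance -/

section Profile

/-- The step of a spin: `↓ ↦ +1`, `↑ ↦ -1`. [folklore] -/
def eps (x : Bool) : ℤ := if x then 1 else -1

/-- **The height profile** `D_σ(k) = Σ_{positions i ≤ k} ε(σ̂_i)` (`ε(↓) = 1`, `ε(↑) = -1`), written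
as a sum over the sites `p` of the contributions of the positions `2p, 2p+1`. [folklore] -/
def dProfile (σ : SpinConfig (2 * m + 1)) (k : ℕ) : ℤ :=
  ∑ p : Fin (m + 1), ((if 2 * p.val + 1 ≤ k then eps (sh σ (2 * p.val + 1)) else 0) + if 2 * p.val ≤ k then eps (sh σ (2 * p.val)) else 0)

/-- **The height profile as a sum over the arcs of a state.** [folklore] -/
theorem dProfile_eq_sum_arcs (s : NCState (m + 1)) (σ : SpinConfig (2 * m + 1)) (k : ℕ) :
    dProfile σ k = ∑ p : Fin (m + 1), ((if 2 * p.val + 1 ≤ k then eps (sh σ (2 * p.val + 1)) else 0) +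
      if 2 * (nxt s p).val ≤ k then eps (sh σ (2 * (nxt s p).val)) else 0) := by
  unfold dProfile
  rw [sum_add_distrib, sum_add_distrib]
  congr 1
  exact (Function.Bijective.sum_comp (nxt_bijective s) (fun j => if 2 * j.val ≤ k then eps (sh σ (2 * j.val)) else 0)).symm

/-- The termwise dominance. [folklore] -/
theorem profileTerm_le {a b k : ℕ} {x y : Bool} (hxy : x ≠ y) (f : Bool) (hf : f = true ↔ a < b) :
    ((if a ≤ k then eps x else 0) + if b ≤ k then eps y else 0) ≤
      (if a ≤ k then eps f else 0) + if b ≤ k then eps (!f) else 0 := by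
  unfold eps
  cases f <;> cases x <;> cases y <;> simp at hxy hf <;> by_cases h1 : a ≤ k <;> by_cases h2 : b ≤ k <;> simp [h1, h2] <;> omega

/-- The termwise equality forces the spin at the left endpoint. [folklore] -/
theorem profileTerm_eq {a b : ℕ} (hab : a ≠ b) {x y : Bool} (hxy : x ≠ y) (f : Bool) (hf : f = true ↔ a < b)
    (h : ((if a ≤ min a b then eps x else 0) + if b ≤ min a b then eps y else 0) =
      (if a ≤ min a b then eps f else 0) + if b ≤ min a b then eps (!f) else 0) :
    x = f := by
  unfold eps at h
  cases f <;> cases x <;> cases y <;> simp at hxy hf ⊢ <;>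
    simp [show (a ≤ min a b ↔ a ≤ b) from by omega, show (b ≤ min a b ↔ b ≤ a) from by omega] at h <;>
    by_cases h1 : a ≤ b <;> by_cases h2 : b ≤ a <;> simp [h1, h2] at h <;> omega

variable {q : ℂ} {s : NCState (m + 1)} {σ : SpinConfig (2 * m + 1)}

/-- **Compatibility**: if `Mc(σ, s) ≠ 0` every arc of `s` carries opposite spins. [folklore] -/
theorem sh_ne_of_embMc_ne_zero (h : embMc q σ s ≠ 0) (p : Fin (m + 1)) : sh σ (2 * p.val + 1) ≠ sh σ (2 * (nxt s p).val) := by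
  intro he
  apply h
  unfold embMc
  refine prod_eq_zero (mem_univ p) ?_
  unfold arcW Wt cW
  rw [he]; split_ifs <;> first | rfl | exact absurd rfl ‹_›

/-- **Dominance**: `Mc(σ, s) ≠ 0 ⇒ D_σ ≤ D_{τ_s}` pointwise. [folklore] -/
theorem dProfile_le_of_embMc_ne_zero (h : embMc q σ s ≠ 0) (k : ℕ) : dProfile σ k ≤ dProfile (tauConf s) k := by
  rw [dProfile_eq_sum_arcs s σ, dProfile_eq_sum_arcs s (tauConf s)]
  refine sum_le_sum fun p _ => ?_
  rw [sh_tauConf_out, sh_tauConf_in_nxt]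
  exact profileTerm_le (k := k) (sh_ne_of_embMc_ne_zero h p) (decide (p < nxt s p))
    (by rw [decide_eq_true_iff, Fin.lt_def]; omega)

/-- **The equality case of dominance**: `D_σ = D_{τ_s}` pointwise and `Mc(σ, s) ≠ 0` force `σ = τ_s`. [folklore] -/
theorem eq_tauConf_of_dProfile_eq (h : embMc q σ s ≠ 0) (heq : ∀ k, dProfile σ k = dProfile (tauConf s) k) : σ = tauConf s := by
  -- the spins at the out-positions
  have hout : ∀ p : Fin (m + 1), sh σ (2 * p.val + 1) = decide (p < nxt s p) := by
    intro p
    set k := min (2 * p.val + 1) (2 * (nxt s p).val) with hk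
    have hsum := heq k
    rw [dProfile_eq_sum_arcs s σ, dProfile_eq_sum_arcs s (tauConf s)] at hsum
    have hle : ∀ p' ∈ (univ : Finset (Fin (m + 1))),
        ((if 2 * p'.val + 1 ≤ k then eps (sh σ (2 * p'.val + 1)) else 0) + if 2 * (nxt s p').val ≤ k then eps (sh σ (2 * (nxt s p').val)) else 0) ≤
        (if 2 * p'.val + 1 ≤ k then eps (sh (tauConf s) (2 * p'.val + 1)) else 0) +
          if 2 * (nxt s p').val ≤ k then eps (sh (tauConf s) (2 * (nxt s p').val)) else 0 := by
      intro p' _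
      rw [sh_tauConf_out, sh_tauConf_in_nxt]
      exact profileTerm_le (k := k) (sh_ne_of_embMc_ne_zero h p') (decide (p' < nxt s p'))
        (by rw [decide_eq_true_iff, Fin.lt_def]; omega)
    have hterm := (sum_eq_sum_iff_of_le hle).1 hsum p (mem_univ p)
    rw [sh_tauConf_out, sh_tauConf_in_nxt] at hterm
    have hab : 2 * p.val + 1 ≠ 2 * (nxt s p).val := by omega
    exact profileTerm_eq hab (sh_ne_of_embMc_ne_zero h p) (decide (p < nxt s p))
      (by rw [decide_eq_true_iff, Fin.lt_def]; omega) hterm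
  -- hence at the in-positions
  have hin : ∀ p : Fin (m + 1), sh σ (2 * (nxt s p).val) = !decide (p < nxt s p) := by
    intro p
    have h1 := sh_ne_of_embMc_ne_zero h p
    rw [hout p] at h1
    cases hh : sh σ (2 * (nxt s p).val) <;> cases hd : decide (p < nxt s p) <;> simp_all
  -- all sites
  funext i
  have hi := i.isLt
  rcases Nat.even_or_odd i.val with ⟨r, hr⟩ | ⟨r, hr⟩
  · -- site `2r` = out-position of `r`
    have hp : r < m + 1 := by omega
    have e1 : σ i = sh σ (2 * (⟨r, hp⟩ : Fin (m + 1)).val + 1) := by rw [← sh_site σ i]; congr 1; simp only; omega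
    have e2 : tauConf s i = sh (tauConf s) (2 * (⟨r, hp⟩ : Fin (m + 1)).val + 1) := by
      rw [← sh_site (tauConf s) i]; congr 1; simp only; omega
    rw [e1, e2, hout ⟨r, hp⟩, sh_tauConf_out]
  · -- site `2r+1` = in-position of `r+1 = nxt (prd (r+1))`
    have hp : r + 1 < m + 1 := by omega
    set j : Fin (m + 1) := ⟨r + 1, hp⟩ with hj
    have e1 : σ i = sh σ (2 * (nxt s (prd s j)).val) := by rw [nxt_prd, ← sh_site σ i]; congr 1; simp [hj]; omega
    have e2 : tauConf s i = sh (tauConf s) (2 * (nxt s (prd s j)).val) := by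
      rw [nxt_prd, ← sh_site (tauConf s) i]; congr 1; simp [hj]; omega
    rw [e1, e2, hin (prd s j), sh_tauConf_in_nxt]

/-- **The sector of the embedding**: `Mc(σ, s) ≠ 0` forces exactly `m` down spins (each of the
`m+1` arcs carries one `↓`, and the boundary position is one of them). [cite: IkhlefPonsaing2012, §3.1] -/
theorem downCount_eq_of_embMc_ne_zero (h : embMc q σ s ≠ 0) : downCount σ = m := by
  let cnt : Bool → ℕ := fun x => if x = true then 1 else 0
  -- one down spin per arc
  have harc : ∀ p : Fin (m + 1), cnt (sh σ (2 * p.val + 1)) + cnt (sh σ (2 * (nxt s p).val)) = 1 := by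
    intro p
    have := sh_ne_of_embMc_ne_zero h p
    cases h1 : sh σ (2 * p.val + 1) <;> cases h2 : sh σ (2 * (nxt s p).val) <;> simp_all [cnt]
  have hsum : ∑ p : Fin (m + 1), (cnt (sh σ (2 * p.val + 1)) + cnt (sh σ (2 * p.val))) = m + 1 := by
    have e : ∑ p : Fin (m + 1), (cnt (sh σ (2 * p.val + 1)) + cnt (sh σ (2 * (nxt s p).val))) = m + 1 := by
      rw [sum_congr rfl fun p _ => harc p]; simp
    rw [sum_add_distrib] at e ⊢
    rw [← (Function.Bijective.sum_comp (nxt_bijective s) (fun j => cnt (sh σ (2 * j.val))))]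
    exact e
  -- the positions `0, …, 2m+1` versus the sites
  have hpos : ∑ k ∈ range (2 * (m + 1)), cnt (sh σ k) = m + 1 := by
    rw [← Literature.Computability.QuantumComplexity.BravyiGosset.sum_range_pairs, ← Fin.sum_univ_eq_sum_range (fun p => cnt (sh σ (2 * p)) + cnt (sh σ (2 * p + 1))) (m + 1)]
    refine Eq.trans ?_ hsum
    refine sum_congr rfl fun p _ => ?_
    exact Nat.add_comm _ _
  have h0 : cnt (sh σ 0) = 1 := by simp [cnt, sh]
  have hsites : ∑ k ∈ range (2 * m + 1), cnt (sh σ (k + 1)) = downCount σ := by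
    rw [downCount, card_filter, ← Fin.sum_univ_eq_sum_range (fun k => cnt (sh σ (k + 1))) (2 * m + 1)]
    exact sum_congr rfl fun i _ => by rw [sh_site]
  rw [show 2 * (m + 1) = 2 * m + 1 + 1 by ring, sum_range_succ', h0, hsites] at hpos
  omega

end Profile

/-! ### Linear independence of the columns and the left inverse -/

section Independence

variable {q : ℂ} (hq : q ^ 2 + q + 1 = 0)

/-- The area of the test profile of a state. [folklore] -/
def tauArea (s : NCState (m + 1)) : ℤ := ∑ k ∈ range (2 * m + 2), dProfile (tauConf s) k

include hq

/-- **The columns `Mc(·, s)` of the embedding are linearly independent.** [folklore] -/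
theorem embMc_linearIndependent (a : NCState (m + 1) → ℂ) (h : ∀ σ, ∑ s, embMc q σ s * a s = 0) : a = 0 := by
  classical
  have hq0 : q ≠ 0 := ne_zero_of_quad' hq
  by_contra hne
  have hS : (univ.filter fun s => a s ≠ 0).Nonempty := by
    by_contra hempty
    rw [not_nonempty_iff_eq_empty, filter_eq_empty_iff] at hempty
    exact hne (funext fun s => by simpa using hempty (mem_univ s))
  obtain ⟨s₀, hs₀, hmax⟩ := exists_max_image _ tauArea hS
  rw [mem_filter] at hs₀
  have key := h (tauConf s₀)
  rw [sum_eq_single s₀] at key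
  · rw [embMc_tauConf_self] at key
    exact hs₀.2 ((mul_eq_zero.1 key).resolve_left (pow_ne_zero _ (neg_ne_zero.2 hq0)))
  · intro s _ hs
    by_cases has : a s = 0
    · rw [has, mul_zero]
    by_cases hM : embMc q (tauConf s₀) s = 0
    · rw [hM, zero_mul]
    exfalso
    -- dominance and maximality force `τ_{s₀} = τ_s`, hence `s₀ = s`
    have hdom := dProfile_le_of_embMc_ne_zero hM
    have hle : tauArea s₀ ≤ tauArea s := sum_le_sum fun k _ => hdom k
    have hge : tauArea s ≤ tauArea s₀ := hmax s (mem_filter.2 ⟨mem_univ _, has⟩)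
    have heqA : tauArea s₀ = tauArea s := le_antisymm hle hge
    have hpt : ∀ k, dProfile (tauConf s₀) k = dProfile (tauConf s) k := by
      intro k
      by_cases hk : k < 2 * m + 2
      · have := (sum_eq_sum_iff_of_le (fun k _ => hdom k)).1 heqA k (mem_range.2 hk)
        exact this
      · -- beyond the last position both profiles are the full sums
        have hfull : ∀ τ : SpinConfig (2 * m + 1), dProfile τ k = dProfile τ (2 * m + 1) := fun τ => by
          unfold dProfile
          refine sum_congr rfl fun p _ => ?_
          have := p.isLt
          rw [if_pos (by omega), if_pos (by omega), if_pos (by omega), if_pos (by omega)]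
        rw [hfull, hfull]
        exact (sum_eq_sum_iff_of_le (fun k _ => hdom k)).1 heqA (2 * m + 1) (mem_range.2 (by omega))
    have := eq_tauConf_of_dProfile_eq hM hpt
    exact hs (tauConf_injective this).symm
  · intro h'; exact absurd (mem_univ s₀) h'

/-- **The embedding has a left inverse with constant coefficients.** [folklore] -/
theorem exists_leftInverse_embMc : ∃ N : NCState (m + 1) → SpinConfig (2 * m + 1) → ℂ,
    ∀ s s', ∑ σ, N s σ * embMc q σ s' = if s = s' then 1 else 0 := by
  classical
  -- the linear map
  let M : (NCState (m + 1) → ℂ) →ₗ[ℂ] (SpinConfig (2 * m + 1) → ℂ) :=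
    { toFun := fun a σ => ∑ s, embMc q σ s * a s
      map_add' := fun a b => by funext σ; simp only [Pi.add_apply, mul_add, sum_add_distrib]
      map_smul' := fun c a => by funext σ; simp only [Pi.smul_apply, smul_eq_mul, RingHom.id_apply, mul_sum]; refine sum_congr rfl fun s _ => ?_; ring }
  have hinj : Function.Injective M := by
    rw [← LinearMap.ker_eq_bot, LinearMap.ker_eq_bot']
    intro a ha
    exact embMc_linearIndependent hq a fun σ => congrFun ha σ
  obtain ⟨g, hg⟩ := LinearMap.exists_leftInverse_of_injective M (LinearMap.ker_eq_bot.2 hinj)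
  refine ⟨fun s σ => g (Pi.single σ 1) s, fun s s' => ?_⟩
  have h1 : g (M (Pi.single s' 1)) = Pi.single s' 1 := by
    have := congrArg (fun f => f (Pi.single s' 1)) hg
    simpa using this
  have h2 : M (Pi.single s' 1) = ∑ σ, embMc q σ s' • (Pi.single σ (1 : ℂ) : SpinConfig (2 * m + 1) → ℂ) := by
    funext σ
    simp only [M, LinearMap.coe_mk, AddHom.coe_mk, Finset.sum_apply, Pi.smul_apply, smul_eq_mul]
    rw [sum_eq_single s', sum_eq_single σ]
    · simp
    · intro σ' _ hne; simp [Pi.single_eq_of_ne (Ne.symm hne)]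
    · intro h'; exact absurd (mem_univ σ) h'
    · intro s _ hne; simp [Pi.single_eq_of_ne hne]
    · intro h'; exact absurd (mem_univ s') h'
  rw [h2, map_sum] at h1
  have h3 := congrFun h1 s
  simp only [Finset.sum_apply, map_smul, Pi.smul_apply, smul_eq_mul] at h3
  rw [Pi.single_apply] at h3
  calc ∑ σ, g (Pi.single σ 1) s * embMc q σ s' = ∑ σ, embMc q σ s' * g (Pi.single σ 1) s :=
        sum_congr rfl fun σ _ => mul_comm _ _
    _ = _ := h3

end Independence

end Literature.Probability.Percolation
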